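import Mathlib
import HarnessLib

/-!
# Taylor flatness at the mirror of a positive-time Schwartz function (tool for the collar synthesis of LINES 2/3, ym-idea-11:
# the flatness hypothesis of `PosTimeSynthC`, step S2b of the shared stub `stub_coarseCollarAtomRPFloor` on 23138 / 22956)

For a Schwartz function `v` on `ℝ⁴` with `tsupport v ⊆ {y₀ > 0}`, every derivative vanishes on the closed lower half-space
(`support_iteratedFDeriv_subset`), and iterating the mean value inequality along the vertical segment down to the mirror
(`Convex.norm_image_sub_le_of_norm_fderiv_le`, `norm_fderiv_iteratedFDeriv`) against the Schwartz decay
(`SchwartzMap.one_add_le_sup_seminorm_apply`) gives the flatness-weighted seminorm bound that the quantitative positive-time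
synthesis `PosTimeSynthC b C N` (skeletons «FloorInheritance» v5 / «MarkovFloorInheritance» v3) takes as INPUT:

  `schwartz_flat_of_tsupport_pos : ∃ M_v ≥ 0, ∀ m ≤ N, ∀ z, 0 < z₀ → (1 + ‖z‖)¹⁴ · ‖D^m v(z)‖ ≤ M_v · min(z₀,1)^(5−m)`.

So the synthesis hypothesis of the shared stub applies to the floor datum `v` of `OnsetFloorQ2` with a constant `M_v` that is
uniform in `β`, `μ` and the resolution `s` (idea-crit-9 #75f (iii)).  Mathlib only.

HONEST FRAMING: an analysis lemma; no stub / crux / rung / summit is proved; the Yang–Mills mass gap is NOT proved.  Cell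
`ym-idea-1`, width seat `ym-line-sfw-p2-w5` g16 (free hands). [folklore]
-/

set_option autoImplicit false

noncomputable section

open scoped BigOperators
open Set

namespace Summit.QuantumFields.YangMills.Theorems.RPOnsetFloorCoarseCollar

/-- The unit time vector `e₀` of `ℝ⁴` has norm `1`. [folklore] -/
theorem norm_single_zero_one : ‖(EuclideanSpace.single (0 : Fin 4) (1 : ℝ))‖ = 1 := by
  rw [PiLp.norm_single, norm_one]

/-- **Taylor flatness at the mirror.**  For a Schwartz `v : ℝ⁴ → ℝ` with `tsupport v ⊆ {y₀ > 0}` and every `N`, there is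
`M_v ≥ 0` with `(1 + ‖z‖)¹⁴ · ‖D^m v(z)‖ ≤ M_v · min(z₀,1)^(5−m)` for all `m ≤ N` and all `z` with `z₀ > 0`.  Proof: all
`D^k v` vanish on `{y₀ ≤ 0}` (`support_iteratedFDeriv_subset`); the mean value inequality on the vertical segment from the
mirror to `z` (`Convex.norm_image_sub_le_of_norm_fderiv_le`, `norm_fderiv_iteratedFDeriv`) iterated `5 − m` times; the
Schwartz decay `(1+‖w‖)¹⁴‖D^k v(w)‖ ≤ A` (`SchwartzMap.one_add_le_sup_seminorm_apply`) and `1 + ‖z‖ ≤ 2(1 + ‖w‖)` on the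
segment when `z₀ ≤ 1`. [folklore] -/
theorem schwartz_flat_of_tsupport_pos (v : SchwartzMap (EuclideanSpace ℝ (Fin 4)) ℝ)
    (hv : tsupport (v : EuclideanSpace ℝ (Fin 4) → ℝ) ⊆ {y : EuclideanSpace ℝ (Fin 4) | 0 < y 0}) (N : ℕ) :
    ∃ Mv : ℝ, 0 ≤ Mv ∧ ∀ m : ℕ, m ≤ N → ∀ z : EuclideanSpace ℝ (Fin 4), 0 < z 0 →
      (1 + ‖z‖) ^ 14 * ‖iteratedFDeriv ℝ m v z‖ ≤ Mv * (min (z 0) 1) ^ (5 - m) := by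
  -- one Schwartz constant for all derivatives of order ≤ max N 5
  set A : ℝ := 2 ^ 14 * (Finset.Iic ((14 : ℕ), max N 5)).sup
    (fun p : ℕ × ℕ => SchwartzMap.seminorm ℝ p.1 p.2) v with hA
  have hA0 : 0 ≤ A := by positivity
  have hdecay : ∀ k : ℕ, k ≤ max N 5 → ∀ w : EuclideanSpace ℝ (Fin 4),
      (1 + ‖w‖) ^ 14 * ‖iteratedFDeriv ℝ k v w‖ ≤ A := fun k hk w =>
    SchwartzMap.one_add_le_sup_seminorm_apply (m := ((14 : ℕ), max N 5)) (k := 14) (n := k) le_rfl hk v w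
  -- all derivatives vanish on the closed lower half-space
  have hvan : ∀ (k : ℕ) (u : EuclideanSpace ℝ (Fin 4)), u 0 ≤ 0 → iteratedFDeriv ℝ k v u = 0 := by
    intro k u hu
    by_contra hne
    have hmem := support_iteratedFDeriv_subset (𝕜 := ℝ) (n := k) (f := (v : EuclideanSpace ℝ (Fin 4) → ℝ))
      (Function.mem_support.2 hne)
    exact absurd (hv hmem) (not_lt.2 hu)
  -- differentiability of the derivatives, with the norm of the derivative
  have hdiff : ∀ k : ℕ, Differentiable ℝ (iteratedFDeriv ℝ k (v : EuclideanSpace ℝ (Fin 4) → ℝ)) := fun k =>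
    (v.smooth (k + 1 : ℕ)).differentiable_iteratedFDeriv (by exact_mod_cast Nat.lt_succ_self k)
  -- the constant
  set B : ℝ := 2 ^ 14 * A with hB
  have hB0 : 0 ≤ B := by positivity
  -- the induction along the vertical segment: for `z` with `0 < z 0 ≤ 1`, every `w` below `z` on its vertical line with
  -- `0 ≤ w 0` satisfies `(1+‖z‖)^14 ‖D^(5-j) v (w)‖ ≤ B (w 0)^j`
  have key : ∀ (z : EuclideanSpace ℝ (Fin 4)), 0 < z 0 → z 0 ≤ 1 → ∀ j : ℕ, j ≤ 5 →
      ∀ w : EuclideanSpace ℝ (Fin 4), (∀ i, i ≠ 0 → w i = z i) → 0 ≤ w 0 → w 0 ≤ z 0 →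
        (1 + ‖z‖) ^ 14 * ‖iteratedFDeriv ℝ (5 - j) v w‖ ≤ B * (w 0) ^ j := by
    intro z hz0 hz1
    -- geometry: points below `z` on its vertical line are within distance `1` of `z`
    have hclose : ∀ w : EuclideanSpace ℝ (Fin 4), (∀ i, i ≠ 0 → w i = z i) → 0 ≤ w 0 → w 0 ≤ z 0 →
        1 + ‖z‖ ≤ 2 * (1 + ‖w‖) := by
      intro w hw hw0 hwz
      have hzw : z - w = (z 0 - w 0) • EuclideanSpace.single (0 : Fin 4) (1 : ℝ) := by
        ext i
        simp only [PiLp.sub_apply, PiLp.smul_apply, PiLp.single_apply, smul_eq_mul]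
        by_cases hi : i = 0
        · subst hi; simp
        · rw [hw i hi]; simp [hi]
      have hnorm : ‖z - w‖ ≤ 1 := by
        rw [hzw, norm_smul, norm_single_zero_one, mul_one, Real.norm_eq_abs, abs_of_nonneg (by linarith)]
        linarith
      have h := norm_le_norm_add_norm_sub' z w
      linarith [norm_sub_rev z w, norm_nonneg w]
    intro j
    induction j with
    | zero =>
      intro _ w hw hw0 hwz
      rw [pow_zero, mul_one, Nat.sub_zero]
      have h1 := hdecay 5 (le_max_right _ _) w
      have h2 := hclose w hw hw0 hwz
      have h3 : (1 + ‖z‖) ^ 14 ≤ 2 ^ 14 * (1 + ‖w‖) ^ 14 := by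
        calc (1 + ‖z‖) ^ 14 ≤ (2 * (1 + ‖w‖)) ^ 14 := pow_le_pow_left₀ (by positivity) h2 14
          _ = 2 ^ 14 * (1 + ‖w‖) ^ 14 := by ring
      calc (1 + ‖z‖) ^ 14 * ‖iteratedFDeriv ℝ 5 v w‖ ≤ 2 ^ 14 * (1 + ‖w‖) ^ 14 * ‖iteratedFDeriv ℝ 5 v w‖ :=
            mul_le_mul_of_nonneg_right h3 (norm_nonneg _)
        _ = 2 ^ 14 * ((1 + ‖w‖) ^ 14 * ‖iteratedFDeriv ℝ 5 v w‖) := by ring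
        _ ≤ 2 ^ 14 * A := mul_le_mul_of_nonneg_left h1 (by positivity)
        _ = B := by rw [hB]
    | succ j ih =>
      intro hj w hw hw0 hwz
      have hj' : j ≤ 5 := Nat.le_of_succ_le hj
      have hk : 5 - j = (5 - (j + 1)) + 1 := by omega
      -- the foot of the vertical segment
      set p : EuclideanSpace ℝ (Fin 4) := w - (w 0) • EuclideanSpace.single (0 : Fin 4) (1 : ℝ) with hp
      have hp0 : p 0 = 0 := by simp [hp]
      have hpi : ∀ i, i ≠ 0 → p i = w i := fun i hi => by simp [hp, hi]
      -- points of the segment `[p, w]`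
      have hseg : ∀ u ∈ segment ℝ p w, (∀ i, i ≠ 0 → u i = z i) ∧ 0 ≤ u 0 ∧ u 0 ≤ w 0 := by
        intro u hu
        rw [segment_eq_image ℝ p w] at hu
        obtain ⟨θ, ⟨hθ0, hθ1⟩, rfl⟩ := hu
        refine ⟨fun i hi => ?_, ?_, ?_⟩
        · simp only [PiLp.add_apply, PiLp.smul_apply, smul_eq_mul, hpi i hi, hw i hi]; ring
        · simp only [PiLp.add_apply, PiLp.smul_apply, smul_eq_mul, hp0, mul_zero, zero_add]
          exact mul_nonneg hθ0 hw0
        · simp only [PiLp.add_apply, PiLp.smul_apply, smul_eq_mul, hp0, mul_zero, zero_add]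
          nlinarith
      -- derivative bound on the segment from the induction hypothesis
      have hbound : ∀ u ∈ segment ℝ p w,
          ‖fderiv ℝ (iteratedFDeriv ℝ (5 - (j + 1)) (v : EuclideanSpace ℝ (Fin 4) → ℝ)) u‖ ≤
            B * (w 0) ^ j / (1 + ‖z‖) ^ 14 := by
        intro u hu
        obtain ⟨hui, hu0, huw⟩ := hseg u hu
        rw [norm_fderiv_iteratedFDeriv, ← hk]
        have h := ih hj' u hui hu0 (huw.trans hwz)
        have hpos : 0 < (1 + ‖z‖) ^ 14 := by positivity
        rw [le_div_iff₀ hpos, mul_comm]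
        refine h.trans ?_
        exact mul_le_mul_of_nonneg_left (pow_le_pow_left₀ hu0 huw j) hB0
      -- mean value inequality on the segment, foot value zero
      have hmvt := (convex_segment p w).norm_image_sub_le_of_norm_fderiv_le
        (fun u _ => (hdiff (5 - (j + 1))).differentiableAt) hbound (left_mem_segment ℝ p w) (right_mem_segment ℝ p w)
      rw [hvan _ p hp0.le, sub_zero] at hmvt
      have hwp : ‖w - p‖ = w 0 := by
        have : w - p = (w 0) • EuclideanSpace.single (0 : Fin 4) (1 : ℝ) := by rw [hp]; abel
        rw [this, norm_smul, norm_single_zero_one, mul_one, Real.norm_eq_abs, abs_of_nonneg hw0]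
      rw [hwp] at hmvt
      have hpos : 0 < (1 + ‖z‖) ^ 14 := by positivity
      calc (1 + ‖z‖) ^ 14 * ‖iteratedFDeriv ℝ (5 - (j + 1)) v w‖
          ≤ (1 + ‖z‖) ^ 14 * (B * (w 0) ^ j / (1 + ‖z‖) ^ 14 * w 0) :=
            mul_le_mul_of_nonneg_left hmvt hpos.le
        _ = B * (w 0) ^ (j + 1) := by field_simp; ring
  -- the constant and the three cases
  refine ⟨B + A, by positivity, fun m hm z hz => ?_⟩
  have hmin0 : 0 < min (z 0) 1 := lt_min hz one_pos
  have hmin1 : min (z 0) 1 ≤ 1 := min_le_right _ _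
  have hpowle : (min (z 0) 1) ^ (5 - m) ≤ 1 := pow_le_one₀ hmin0.le hmin1
  have hpow0 : 0 < (min (z 0) 1) ^ (5 - m) := pow_pos hmin0 _
  by_cases hm5 : m ≤ 5
  · by_cases hz1 : z 0 ≤ 1
    · -- flat regime
      have h := key z hz hz1 (5 - m) (by omega) z (fun i _ => rfl) hz.le le_rfl
      have hmm : 5 - (5 - m) = m := by omega
      rw [hmm] at h
      rw [min_eq_left hz1]
      calc (1 + ‖z‖) ^ 14 * ‖iteratedFDeriv ℝ m v z‖ ≤ B * (z 0) ^ (5 - m) := h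
        _ ≤ (B + A) * (z 0) ^ (5 - m) := mul_le_mul_of_nonneg_right (by linarith) (pow_nonneg hz.le _)
    · -- far from the mirror: plain Schwartz bound
      push Not at hz1
      rw [min_eq_right hz1.le, one_pow, mul_one]
      exact (hdecay m (hm.trans (le_max_left _ _)) z).trans (by linarith)
  · -- high derivatives: exponent `5 - m = 0`
    push Not at hm5
    have h0 : 5 - m = 0 := by omega
    rw [h0, pow_zero, mul_one]
    exact (hdecay m (hm.trans (le_max_left _ _)) z).trans (by linarith)

end Summit.QuantumFields.YangMills.Theorems.RPOnsetFloorCoarseCollar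

end
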